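import Summits.ValiantsHypothesis.ValiantsHypothesis.Theorems.FermionicJetQuadraticDcCdetOperator

/-!
# Route `FermionicJet`, crux `QuadraticDcCdet` (stmt-ValiantsHypothesis-5343) — helper 5a:
# kernel of the pattern matrix, invariant part

On the index type `ι = Option (Option γ)` (`|γ| = k + 3`, so `n = |ι| = k + 5 ≥ 5`) with
`p = none`, `q = some none`, consider the pattern matrix `M` of helpers 3–4 (the Hessian of `cdet_n`
at the all-ones matrix with `(p, q)` entry `3 - n`, up to the unit `(-1)^k k!`; `α = -(k+1)`,
`β = k+3`) and a vector `v` with `M *ᵥ v = 0`, written through the closed form of helper 4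
(`patternMulVec_apply`).  This file proves that the ten `𝔖_{n-2}`-invariant aggregates of `v`
(`v(p,p), v(q,q), v(p,q), v(q,p)`, the row/column sums of `v` over `R = ι ∖ {p,q}` at `p` and `q`,
the `R`-trace and the `R × R` total) vanish (`patternKernel_aggregates`): they satisfy a `10 × 10`
homogeneous linear system whose determinant is `-8(n-1)²(n-3)⁴(2n-7)(n-4)⁸ ≠ 0`; the elimination
certificates (polynomial multipliers in `k` of degree ≤ 5, computed exactly) are checked by `ring`.
HONEST FRAMING: a quadratic `dc` lower bound for a dormant route's polynomial; nothing here bears on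
`VP ≠ VNP`, which is NOT proved.
-/

noncomputable section

open Finset

-- layout Summits/ValiantsHypothesis/ValiantsHypothesis forces the duplicated namespace component
set_option linter.dupNamespace false

namespace Summit.ValiantsHypothesis.ValiantsHypothesis.Theorems.FermionicJet.CdetHessian

/-- Splitting the diagonal out of a double sum. -/
theorem sum_sum_ite_eq_diag {K : Type*} [CommRing K] {γ : Type*} [Fintype γ] [DecidableEq γ]
    (A B : γ → γ → K) :
    (∑ j, ∑ i, if j = i then A j i else B j i) = (∑ j, A j j) + (∑ j, ∑ i, B j i) - ∑ j, B j j := by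
  have h : ∀ j i, (if j = i then A j i else B j i) = B j i + (if i = j then A j j
      - B j j else 0) := by
    intro j i
    by_cases hji : j = i
    · subst hji; simp
    · rw [if_neg hji, if_neg (Ne.symm hji), add_zero]
  simp_rw [h]
  simp only [Finset.sum_add_distrib, Finset.sum_ite_eq', Finset.mem_univ, if_true,
    Finset.sum_sub_distrib]
  ring

set_option maxHeartbeats 4000000 in
/-- **The invariant aggregates vanish** (`n = k + 5 ≥ 5`): if the closed form of `M *ᵥ v`
(helper 4, `patternMulVec_apply`, with `p = none`, `q = some none`, `α = -(k+1)`, `β = k+3`)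
vanishes identically, then the ten `𝔖_{n-2}`-invariant aggregates of `v` are zero. -/
theorem patternKernel_aggregates {K : Type*} [Field K] [CharZero K] {γ : Type*} [Fintype γ]
    [DecidableEq γ] (k : ℕ) (hγ : Fintype.card γ = k + 3)
    (v : Option (Option γ) × Option (Option γ) → K)
    (hcf : ∀ c d : Option (Option γ),
      ((-((k : K) + 1)) * (if c = d then
          2 * (∑ a, v (a, a)) - 3 * v (c, c) - ((∑ x, v x) - (∑ b, v (c, b)) - ∑ a, v (a, c))
        else
          ((∑ x, v x) - (∑ b, v (c, b)) - (∑ a, v (a, d)) + v (c, d))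
            - 2 * ((∑ a, v (a, a)) - v (c, c) - v (d, d)) - 2 * v (d, c)) +
      ((k : K) + 3) * (if d = some none ∨ c = none then 0 else
        if (if c = some none then none else c) = d then
          2 * ((∑ a, v (a, if a = some none then none else a)) - v (none, none)) - 2 * v (c, d)
            - ((∑ x, v x) - (∑ b, v (c, b)) - (∑ b, v (none, b)) - (∑ a, v (a, d))
                - (∑ a, v (a, some none)) + v (c, d) + v (c, some none) + v (none, d)
                + v (none, some none))
        else
          ((∑ x, v x) - (∑ b, v (c, b)) - (∑ b, v (none, b)) - (∑ a, v (a, d))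
              - (∑ a, v (a, some none)) + v (c, d) + v (c, some none) + v (none, d)
              + v (none, some none))
            - 2 * ((∑ a, v (a, if a = some none then none else a)) - v (none, none)
                - v (c, if c = some none then none else c)
                - v ((if d = none then some none else d), d))
            - 2 * v ((if d = none then some none else d), (if c = some none then none else c)))) = 0) :
    v (none, none) = 0 ∧ v (some none, some none) = 0 ∧ v (none, some none) = 0 ∧
      v (some none, none) = 0 ∧ (∑ j, v (none, some (some j))) = 0 ∧
      (∑ j, v (some none, some (some j))) = 0 ∧ (∑ j, v (some (some j), none)) = 0 ∧
      (∑ j, v (some (some j), some none)) = 0 ∧ (∑ j, v (some (some j), some (some j))) = 0 ∧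
      (∑ j, ∑ i, v (some (some j), some (some i))) = 0 := by
  have hcm : (∑ j : γ, ∑ i : γ, v (some (some i), some (some j))) =
      ∑ i : γ, ∑ j : γ, v (some (some i), some (some j)) := Finset.sum_comm
  have e_pp : ((-1 : K) + (-1 : K) * (k : K)) * v (some none, some none) + ((1 : K)
      + (1 : K) * (k : K)) * (∑ j, v (some none, some (some j))) + ((1 : K)
      + (1 : K) * (k : K)) * (∑ j, v (some (some j), some none)) + ((-2 : K)
      + (-2 : K) * (k : K)) * (∑ j, v (some (some j), some (some j))) + ((1 : K)
      + (1 : K) * (k : K)) * (∑ j, ∑ i, v (some (some j), some (some i))) = 0 := by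
    have h := hcf none none
    simp only [Fintype.sum_option, Fintype.sum_prod_type, if_true, if_false, reduceCtorEq,
      Option.some.injEq, or_true, Finset.sum_add_distrib, mul_zero, add_zero] at h
    linear_combination h
  have e_qq : ((-1 : K) + (-1 : K) * (k : K)) * v (none, none) + ((1 : K)
      + (1 : K) * (k : K)) * (∑ j, v (none, some (some j))) + ((1 : K)
      + (1 : K) * (k : K)) * (∑ j, v (some (some j), none)) + ((-2 : K)
      + (-2 : K) * (k : K)) * (∑ j, v (some (some j), some (some j))) + ((1 : K)
      + (1 : K) * (k : K)) * (∑ j, ∑ i, v (some (some j), some (some i))) = 0 := by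
    have h := hcf (some none) (some none)
    simp only [Fintype.sum_option, Fintype.sum_prod_type, if_true, if_false, reduceCtorEq,
      Option.some.injEq, or_false, Finset.sum_add_distrib, mul_zero, add_zero] at h
    linear_combination h
  have e_pq : ((1 : K) + (1 : K) * (k : K)) * v (some none, none) + ((-1 : K)
      + (-1 : K) * (k : K)) * (∑ j, v (some none, some (some j))) + ((-1 : K)
      + (-1 : K) * (k : K)) * (∑ j, v (some (some j), none)) + ((2 : K)
      + (2 : K) * (k : K)) * (∑ j, v (some (some j), some (some j))) + ((-1 : K)
      + (-1 : K) * (k : K)) * (∑ j, ∑ i, v (some (some j), some (some i))) = 0 := by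
    have h := hcf none (some none)
    simp only [Fintype.sum_option, Fintype.sum_prod_type, if_true, if_false, reduceCtorEq,
      Option.some.injEq, or_true, Finset.sum_add_distrib, mul_zero, add_zero] at h
    linear_combination h
  have e_qp : ((1 : K) + (1 : K) * (k : K)) * v (none, some none) + ((-1 : K)
      + (-1 : K) * (k : K)) * (∑ j, v (none, some (some j))) + ((-1 : K)
      + (-1 : K) * (k : K)) * (∑ j, v (some (some j), some none)) + ((8 : K)
      + (4 : K) * (k : K)) * (∑ j, v (some (some j), some (some j))) + ((-4 : K)
      + (-2 : K) * (k : K)) * (∑ j, ∑ i, v (some (some j), some (some i))) = 0 := by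
    have h := hcf (some none) none
    simp only [Fintype.sum_option, Fintype.sum_prod_type, if_true, if_false, reduceCtorEq,
      Option.some.injEq, or_false, Finset.sum_add_distrib] at h
    linear_combination h
  have e_rowP : ((3 : K) + (4 : K) * (k : K) + (1 : K) * (k : K) ^ 2) * v (some none, some none)
      + ((-3 : K) + (-4 : K) * (k : K) + (-1 : K) * (k : K) ^ 2) * v (some none, none) + ((-2 : K)
      + (-3 : K) * (k : K) + (-1 : K) * (k : K) ^ 2) * (∑ j, v (some none, some (some j)))
      + ((-1 : K) + (-2 : K) * (k : K) + (-1 : K) * (k : K) ^ 2) * (∑ j, v (some (some j), none))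
      + ((-3 : K) + (-4 : K) * (k : K)
      + (-1 : K) * (k : K) ^ 2) * (∑ j, v (some (some j), some none)) + ((4 : K)
      + (6 : K) * (k : K) + (2 : K) * (k : K) ^ 2) * (∑ j, v (some (some j), some (some j)))
      + ((-2 : K) + (-3 : K) * (k : K)
      + (-1 : K) * (k : K) ^ 2) * (∑ j, ∑ i, v (some (some j), some (some i))) = 0 := by
    have h := Finset.sum_eq_zero (fun (j : γ) (_ : j ∈ Finset.univ) => hcf none (some (some j)))
    simp only [Fintype.sum_option, Fintype.sum_prod_type, if_true, if_false, reduceCtorEq,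
      Option.some.injEq, or_true, ← Finset.mul_sum, Finset.sum_add_distrib,
      Finset.sum_sub_distrib, Finset.sum_const, Finset.card_univ, hγ, nsmul_eq_mul, Nat.cast_add,
      Nat.cast_ofNat, mul_zero, add_zero, hcm] at h
    linear_combination h
  have e_rowQ : ((3 : K) + (4 : K) * (k : K) + (1 : K) * (k : K) ^ 2) * v (none, none) + ((-3 : K)
      + (-4 : K) * (k : K) + (-1 : K) * (k : K) ^ 2) * v (none, some none) + ((-2 : K)
      + (-3 : K) * (k : K) + (-1 : K) * (k : K) ^ 2) * (∑ j, v (none, some (some j))) + ((-1 : K)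
      + (-2 : K) * (k : K) + (-1 : K) * (k : K) ^ 2) * (∑ j, v (some (some j), some none))
      + ((-8 : K) + (-4 : K) * (k : K)) * (∑ j, v (some (some j), some (some j))) + ((4 : K)
      + (2 : K) * (k : K)) * (∑ j, ∑ i, v (some (some j), some (some i))) = 0 := by
    have h := Finset.sum_eq_zero (fun (j : γ) (_ : j ∈ Finset.univ) => hcf (some none) (some (some j)))
    simp only [Fintype.sum_option, Fintype.sum_prod_type, if_true, if_false, reduceCtorEq,
      Option.some.injEq, or_false, ← Finset.mul_sum, Finset.sum_add_distrib,
      Finset.sum_sub_distrib, Finset.sum_const, Finset.card_univ, hγ, nsmul_eq_mul, Nat.cast_add,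
      Nat.cast_ofNat, hcm] at h
    linear_combination h
  have e_colP : ((3 : K) + (4 : K) * (k : K) + (1 : K) * (k : K) ^ 2) * v (some none, some none)
      + ((-3 : K) + (-4 : K) * (k : K) + (-1 : K) * (k : K) ^ 2) * v (none, some none) + ((-1 : K)
      + (-2 : K) * (k : K) + (-1 : K) * (k : K) ^ 2) * (∑ j, v (none, some (some j))) + ((-2 : K)
      + (-3 : K) * (k : K) + (-1 : K) * (k : K) ^ 2) * (∑ j, v (some (some j), some none))
      + ((-8 : K) + (-4 : K) * (k : K)) * (∑ j, v (some (some j), some (some j))) + ((4 : K)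
      + (2 : K) * (k : K)) * (∑ j, ∑ i, v (some (some j), some (some i))) = 0 := by
    have h := Finset.sum_eq_zero (fun (j : γ) (_ : j ∈ Finset.univ) => hcf (some (some j)) none)
    simp only [Fintype.sum_option, Fintype.sum_prod_type, if_true, if_false, reduceCtorEq,
      Option.some.injEq, or_false, ← Finset.mul_sum, Finset.sum_add_distrib,
      Finset.sum_sub_distrib, Finset.sum_const, Finset.card_univ, hγ, nsmul_eq_mul, Nat.cast_add,
      Nat.cast_ofNat] at h
    linear_combination h
  have e_colQ : ((3 : K) + (4 : K) * (k : K) + (1 : K) * (k : K) ^ 2) * v (none, none) + ((-3 : K)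
      + (-4 : K) * (k : K) + (-1 : K) * (k : K) ^ 2) * v (some none, none) + ((-3 : K)
      + (-4 : K) * (k : K) + (-1 : K) * (k : K) ^ 2) * (∑ j, v (none, some (some j))) + ((-1 : K)
      + (-2 : K) * (k : K) + (-1 : K) * (k : K) ^ 2) * (∑ j, v (some none, some (some j)))
      + ((-2 : K) + (-3 : K) * (k : K) + (-1 : K) * (k : K) ^ 2) * (∑ j, v (some (some j), none))
      + ((4 : K) + (6 : K) * (k : K)
      + (2 : K) * (k : K) ^ 2) * (∑ j, v (some (some j), some (some j))) + ((-2 : K)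
      + (-3 : K) * (k : K)
      + (-1 : K) * (k : K) ^ 2) * (∑ j, ∑ i, v (some (some j), some (some i))) = 0 := by
    have h := Finset.sum_eq_zero (fun (j : γ) (_ : j ∈ Finset.univ) => hcf (some (some j)) (some none))
    simp only [Fintype.sum_option, Fintype.sum_prod_type, if_true, if_false, reduceCtorEq,
      Option.some.injEq, or_false, ← Finset.mul_sum, Finset.sum_add_distrib,
      Finset.sum_sub_distrib, Finset.sum_const, Finset.card_univ, hγ, nsmul_eq_mul, Nat.cast_add,
      Nat.cast_ofNat, mul_zero, add_zero] at h
    linear_combination h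
  have e_diag : ((-3 : K) + (-4 : K) * (k : K) + (-1 : K) * (k : K) ^ 2) * v (none, none)
      + ((-3 : K) + (-4 : K) * (k : K) + (-1 : K) * (k : K) ^ 2) * v (some none, some none)
      + ((3 : K) + (4 : K) * (k : K) + (1 : K) * (k : K) ^ 2) * v (none, some none) + ((12 : K)
      + (10 : K) * (k : K) + (2 : K) * (k : K) ^ 2) * v (some none, none) + ((2 : K)
      + (3 : K) * (k : K) + (1 : K) * (k : K) ^ 2) * (∑ j, v (none, some (some j))) + ((-4 : K)
      + (-2 : K) * (k : K)) * (∑ j, v (some none, some (some j))) + ((-4 : K)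
      + (-2 : K) * (k : K)) * (∑ j, v (some (some j), none)) + ((2 : K) + (3 : K) * (k : K)
      + (1 : K) * (k : K) ^ 2) * (∑ j, v (some (some j), some none)) + ((6 : K)
      + (4 : K) * (k : K)) * (∑ j, v (some (some j), some (some j))) + ((-2 : K)
      + (-2 : K) * (k : K)) * (∑ j, ∑ i, v (some (some j), some (some i))) = 0 := by
    have h := Finset.sum_eq_zero (fun (j : γ) (_ : j ∈ Finset.univ) => hcf (some (some j)) (some (some j)))
    simp only [Fintype.sum_option, Fintype.sum_prod_type, if_true, if_false, reduceCtorEq,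
      Option.some.injEq, or_false, ← Finset.mul_sum, Finset.sum_add_distrib,
      Finset.sum_sub_distrib, Finset.sum_const, Finset.card_univ, hγ, nsmul_eq_mul, Nat.cast_add,
      Nat.cast_ofNat, hcm] at h
    linear_combination h
  have e_all : ((3 : K) + (7 : K) * (k : K) + (5 : K) * (k : K) ^ 2
      + (1 : K) * (k : K) ^ 3) * v (none, none) + ((3 : K) + (7 : K) * (k : K)
      + (5 : K) * (k : K) ^ 2 + (1 : K) * (k : K) ^ 3) * v (some none, some none) + ((-3 : K)
      + (-7 : K) * (k : K) + (-5 : K) * (k : K) ^ 2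
      + (-1 : K) * (k : K) ^ 3) * v (none, some none) + ((-12 : K) + (-22 : K) * (k : K)
      + (-12 : K) * (k : K) ^ 2 + (-2 : K) * (k : K) ^ 3) * v (some none, none) + ((-2 : K)
      + (-5 : K) * (k : K) + (-4 : K) * (k : K) ^ 2
      + (-1 : K) * (k : K) ^ 3) * (∑ j, v (none, some (some j))) + ((4 : K) + (6 : K) * (k : K)
      + (2 : K) * (k : K) ^ 2) * (∑ j, v (some none, some (some j))) + ((4 : K)
      + (6 : K) * (k : K) + (2 : K) * (k : K) ^ 2) * (∑ j, v (some (some j), none)) + ((-2 : K)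
      + (-5 : K) * (k : K) + (-4 : K) * (k : K) ^ 2
      + (-1 : K) * (k : K) ^ 3) * (∑ j, v (some (some j), some none)) + ((-8 : K) * (k : K)
      + (-4 : K) * (k : K) ^ 2) * (∑ j, v (some (some j), some (some j))) + ((4 : K) * (k : K)
      + (2 : K) * (k : K) ^ 2) * (∑ j, ∑ i, v (some (some j), some (some i))) = 0 := by
    have h := Finset.sum_eq_zero (fun (j : γ) (_ : j ∈ Finset.univ) => Finset.sum_eq_zero (fun (i : γ) (_ : i ∈ Finset.univ) => hcf (some (some j)) (some (some i))))
    simp only [Fintype.sum_option, Fintype.sum_prod_type, if_true, if_false, reduceCtorEq,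
      Option.some.injEq, or_false, ← Finset.mul_sum, Finset.sum_add_distrib] at h
    rw [sum_sum_ite_eq_diag, sum_sum_ite_eq_diag] at h
    simp only [← Finset.mul_sum, Finset.sum_add_distrib, Finset.sum_sub_distrib,
      Finset.sum_const, Finset.card_univ, hγ, nsmul_eq_mul, Nat.cast_add, Nat.cast_ofNat, hcm] at h
    linear_combination h
  have hP1 : ((192 : K) + (608 : K) * (k : K) + (764 : K) * (k : K) ^ 2 + (488 : K) * (k : K) ^ 3
      + (167 : K) * (k : K) ^ 4 + (29 : K) * (k : K) ^ 5 + (2 : K) * (k : K) ^ 6) ≠ 0 := by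
    rw [show ((192 : K) + (608 : K) * (k : K) + (764 : K) * (k : K) ^ 2 + (488 : K) * (k : K) ^ 3
        + (167 : K) * (k : K) ^ 4 + (29 : K) * (k : K) ^ 5 + (2 : K) * (k : K) ^ 6) = ((192
        + 608 * k + 764 * k ^ 2 + 488 * k ^ 3 + 167 * k ^ 4 + 29 * k ^ 5
        + 2 * k ^ 6 : ℕ) : K) by push_cast; ring, Nat.cast_ne_zero]; omega
  have hP2 : ((96 : K) + (256 : K) * (k : K) + (254 : K) * (k : K) ^ 2 + (117 : K) * (k : K) ^ 3
      + (25 : K) * (k : K) ^ 4 + (2 : K) * (k : K) ^ 5) ≠ 0 := by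
    rw [show ((96 : K) + (256 : K) * (k : K) + (254 : K) * (k : K) ^ 2 + (117 : K) * (k : K) ^ 3
        + (25 : K) * (k : K) ^ 4 + (2 : K) * (k : K) ^ 5) = ((96 + 256 * k + 254 * k ^ 2
        + 117 * k ^ 3 + 25 * k ^ 4
        + 2 * k ^ 5 : ℕ) : K) by push_cast; ring, Nat.cast_ne_zero]; omega
  have hP3 : ((192 : K) + (512 : K) * (k : K) + (508 : K) * (k : K) ^ 2 + (234 : K) * (k : K) ^ 3
      + (50 : K) * (k : K) ^ 4 + (4 : K) * (k : K) ^ 5) ≠ 0 := by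
    rw [show ((192 : K) + (512 : K) * (k : K) + (508 : K) * (k : K) ^ 2 + (234 : K) * (k : K) ^ 3
        + (50 : K) * (k : K) ^ 4 + (4 : K) * (k : K) ^ 5) = ((192 + 512 * k + 508 * k ^ 2
        + 234 * k ^ 3 + 50 * k ^ 4
        + 4 * k ^ 5 : ℕ) : K) by push_cast; ring, Nat.cast_ne_zero]; omega
  have hz1 : v (none, none) = 0 := (mul_eq_zero.mp (show ((192 : K) + (608 : K) * (k : K)
      + (764 : K) * (k : K) ^ 2 + (488 : K) * (k : K) ^ 3 + (167 : K) * (k : K) ^ 4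
      + (29 : K) * (k : K) ^ 5 + (2 : K) * (k : K) ^ 6) * v (none, none) = 0 by
    linear_combination ((-198 : K) + (-414 : K) * (k : K) + (-338 : K) * (k : K) ^ 2
        + (-134 : K) * (k : K) ^ 3 + (-26 : K) * (k : K) ^ 4 + (-2 : K) * (k : K) ^ 5) * e_pp
        + ((-246 : K) + (-470 : K) * (k : K) + (-357 : K) * (k : K) ^ 2 + (-136 : K) * (k : K) ^ 3
        + (-26 : K) * (k : K) ^ 4 + (-2 : K) * (k : K) ^ 5) * e_qq + ((-108 : K)
        + (-240 : K) * (k : K) + (-215 : K) * (k : K) ^ 2 + (-97 : K) * (k : K) ^ 3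
        + (-22 : K) * (k : K) ^ 4 + (-2 : K) * (k : K) ^ 5) * e_pq + ((-90 : K)
        + (-183 : K) * (k : K) + (-147 : K) * (k : K) ^ 2 + (-59 : K) * (k : K) ^ 3
        + (-12 : K) * (k : K) ^ 4 + (-1 : K) * (k : K) ^ 5) * e_qp + ((-6 : K)
        + (-14 : K) * (k : K) + (-10 : K) * (k : K) ^ 2 + (-2 : K) * (k : K) ^ 3) * e_rowP
        + ((30 : K) + (51 : K) * (k : K) + (32 : K) * (k : K) ^ 2 + (9 : K) * (k : K) ^ 3
        + (1 : K) * (k : K) ^ 4) * e_rowQ + ((-66 : K) + (-109 : K) * (k : K)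
        + (-62 : K) * (k : K) ^ 2 + (-14 : K) * (k : K) ^ 3 + (-1 : K) * (k : K) ^ 4) * e_colP
        + ((-54 : K) + (-70 : K) * (k : K) + (-29 : K) * (k : K) ^ 2
        + (-4 : K) * (k : K) ^ 3) * e_colQ + ((6 : K) + (1 : K) * (k : K) + (-3 : K) * (k : K) ^ 2
        + (-1 : K) * (k : K) ^ 3) * e_all)).resolve_left hP1
  have hz2 : v (some none, some none) = 0 := (mul_eq_zero.mp (show ((192 : K)
      + (608 : K) * (k : K) + (764 : K) * (k : K) ^ 2 + (488 : K) * (k : K) ^ 3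
      + (167 : K) * (k : K) ^ 4 + (29 : K) * (k : K) ^ 5
      + (2 : K) * (k : K) ^ 6) * v (some none, some none) = 0 by
    linear_combination ((-246 : K) + (-470 : K) * (k : K) + (-357 : K) * (k : K) ^ 2
        + (-136 : K) * (k : K) ^ 3 + (-26 : K) * (k : K) ^ 4 + (-2 : K) * (k : K) ^ 5) * e_pp
        + ((-198 : K) + (-414 : K) * (k : K) + (-338 : K) * (k : K) ^ 2 + (-134 : K) * (k : K) ^ 3
        + (-26 : K) * (k : K) ^ 4 + (-2 : K) * (k : K) ^ 5) * e_qq + ((-108 : K)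
        + (-240 : K) * (k : K) + (-215 : K) * (k : K) ^ 2 + (-97 : K) * (k : K) ^ 3
        + (-22 : K) * (k : K) ^ 4 + (-2 : K) * (k : K) ^ 5) * e_pq + ((-90 : K)
        + (-183 : K) * (k : K) + (-147 : K) * (k : K) ^ 2 + (-59 : K) * (k : K) ^ 3
        + (-12 : K) * (k : K) ^ 4 + (-1 : K) * (k : K) ^ 5) * e_qp + ((-54 : K)
        + (-70 : K) * (k : K) + (-29 : K) * (k : K) ^ 2 + (-4 : K) * (k : K) ^ 3) * e_rowP
        + ((-66 : K) + (-109 : K) * (k : K) + (-62 : K) * (k : K) ^ 2 + (-14 : K) * (k : K) ^ 3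
        + (-1 : K) * (k : K) ^ 4) * e_rowQ + ((30 : K) + (51 : K) * (k : K)
        + (32 : K) * (k : K) ^ 2 + (9 : K) * (k : K) ^ 3 + (1 : K) * (k : K) ^ 4) * e_colP
        + ((-6 : K) + (-14 : K) * (k : K) + (-10 : K) * (k : K) ^ 2
        + (-2 : K) * (k : K) ^ 3) * e_colQ + ((6 : K) + (1 : K) * (k : K) + (-3 : K) * (k : K) ^ 2
        + (-1 : K) * (k : K) ^ 3) * e_all)).resolve_left hP1
  have hz3 : v (none, some none) = 0 := (mul_eq_zero.mp (show ((96 : K) + (256 : K) * (k : K)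
      + (254 : K) * (k : K) ^ 2 + (117 : K) * (k : K) ^ 3 + (25 : K) * (k : K) ^ 4
      + (2 : K) * (k : K) ^ 5) * v (none, some none) = 0 by
    linear_combination ((-54 : K) + (-93 : K) * (k : K) + (-61 : K) * (k : K) ^ 2
        + (-18 : K) * (k : K) ^ 3 + (-2 : K) * (k : K) ^ 4) * e_pp + ((-54 : K)
        + (-93 : K) * (k : K) + (-61 : K) * (k : K) ^ 2 + (-18 : K) * (k : K) ^ 3
        + (-2 : K) * (k : K) ^ 4) * e_qq + ((-156 : K) + (-286 : K) * (k : K)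
        + (-192 : K) * (k : K) ^ 2 + (-56 : K) * (k : K) ^ 3 + (-6 : K) * (k : K) ^ 4) * e_pq
        + ((-18 : K) + (-28 : K) * (k : K) + (-19 : K) * (k : K) ^ 2 + (-7 : K) * (k : K) ^ 3
        + (-1 : K) * (k : K) ^ 4) * e_qp + ((10 : K) + (19 : K) * (k : K) + (11 : K) * (k : K) ^ 2
        + (2 : K) * (k : K) ^ 3) * e_rowP + ((-10 : K) + (-6 : K) * (k : K)
        + (2 : K) * (k : K) ^ 2 + (1 : K) * (k : K) ^ 3) * e_rowQ + ((-10 : K)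
        + (-6 : K) * (k : K) + (2 : K) * (k : K) ^ 2 + (1 : K) * (k : K) ^ 3) * e_colP + ((10 : K)
        + (19 : K) * (k : K) + (11 : K) * (k : K) ^ 2 + (2 : K) * (k : K) ^ 3) * e_colQ
        + ((-18 : K) + (-20 : K) * (k : K) + (-5 : K) * (k : K) ^ 2) * e_all)).resolve_left hP2
  have hz4 : v (some none, none) = 0 := (mul_eq_zero.mp (show ((192 : K) + (512 : K) * (k : K)
      + (508 : K) * (k : K) ^ 2 + (234 : K) * (k : K) ^ 3 + (50 : K) * (k : K) ^ 4
      + (4 : K) * (k : K) ^ 5) * v (some none, none) = 0 by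
    linear_combination ((-90 : K) + (-138 : K) * (k : K) + (-78 : K) * (k : K) ^ 2
        + (-20 : K) * (k : K) ^ 3 + (-2 : K) * (k : K) ^ 4) * e_pp + ((-90 : K)
        + (-138 : K) * (k : K) + (-78 : K) * (k : K) ^ 2 + (-20 : K) * (k : K) ^ 3
        + (-2 : K) * (k : K) ^ 4) * e_qq + ((-36 : K) + (-56 : K) * (k : K)
        + (-38 : K) * (k : K) ^ 2 + (-14 : K) * (k : K) ^ 3 + (-2 : K) * (k : K) ^ 4) * e_pq
        + ((-6 : K) + (-17 : K) * (k : K) + (-17 : K) * (k : K) ^ 2 + (-7 : K) * (k : K) ^ 3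
        + (-1 : K) * (k : K) ^ 4) * e_qp + ((-26 : K) + (-26 : K) * (k : K)
        + (-6 : K) * (k : K) ^ 2) * e_rowP + ((2 : K) + (5 : K) * (k : K) + (4 : K) * (k : K) ^ 2
        + (1 : K) * (k : K) ^ 3) * e_rowQ + ((2 : K) + (5 : K) * (k : K) + (4 : K) * (k : K) ^ 2
        + (1 : K) * (k : K) ^ 3) * e_colP + ((-26 : K) + (-26 : K) * (k : K)
        + (-6 : K) * (k : K) ^ 2) * e_colQ + ((-6 : K) + (-9 : K) * (k : K)
        + (-3 : K) * (k : K) ^ 2) * e_all)).resolve_left hP3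
  have hz5 : (∑ j, v (none, some (some j))) = 0 := (mul_eq_zero.mp (show ((192 : K)
      + (608 : K) * (k : K) + (764 : K) * (k : K) ^ 2 + (488 : K) * (k : K) ^ 3
      + (167 : K) * (k : K) ^ 4 + (29 : K) * (k : K) ^ 5
      + (2 : K) * (k : K) ^ 6) * (∑ j, v (none, some (some j))) = 0 by
    linear_combination ((-18 : K) + (-48 : K) * (k : K) + (-44 : K) * (k : K) ^ 2
        + (-16 : K) * (k : K) ^ 3 + (-2 : K) * (k : K) ^ 4) * e_pp + ((-162 : K)
        + (-264 : K) * (k : K) + (-157 : K) * (k : K) ^ 2 + (-41 : K) * (k : K) ^ 3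
        + (-4 : K) * (k : K) ^ 4) * e_qq + ((60 : K) + (164 : K) * (k : K)
        + (171 : K) * (k : K) ^ 2 + (86 : K) * (k : K) ^ 3 + (21 : K) * (k : K) ^ 4
        + (2 : K) * (k : K) ^ 5) * e_pq + ((-78 : K) + (-143 : K) * (k : K)
        + (-96 : K) * (k : K) ^ 2 + (-28 : K) * (k : K) ^ 3 + (-3 : K) * (k : K) ^ 4) * e_qp
        + ((46 : K) + (64 : K) * (k : K) + (28 : K) * (k : K) ^ 2
        + (4 : K) * (k : K) ^ 3) * e_rowP + ((26 : K) + (39 : K) * (k : K)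
        + (19 : K) * (k : K) ^ 2 + (3 : K) * (k : K) ^ 3) * e_rowQ + ((-70 : K)
        + (-121 : K) * (k : K) + (-75 : K) * (k : K) ^ 2 + (-20 : K) * (k : K) ^ 3
        + (-2 : K) * (k : K) ^ 4) * e_colP + ((-98 : K) + (-152 : K) * (k : K)
        + (-85 : K) * (k : K) ^ 2 + (-21 : K) * (k : K) ^ 3 + (-2 : K) * (k : K) ^ 4) * e_colQ
        + ((18 : K) + (25 : K) * (k : K) + (12 : K) * (k : K) ^ 2
        + (2 : K) * (k : K) ^ 3) * e_all)).resolve_left hP1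
  have hz6 : (∑ j, v (some none, some (some j))) = 0 := (mul_eq_zero.mp (show ((192 : K)
      + (512 : K) * (k : K) + (508 : K) * (k : K) ^ 2 + (234 : K) * (k : K) ^ 3
      + (50 : K) * (k : K) ^ 4
      + (4 : K) * (k : K) ^ 5) * (∑ j, v (some none, some (some j))) = 0 by
    linear_combination ((90 : K) + (138 : K) * (k : K) + (78 : K) * (k : K) ^ 2
        + (20 : K) * (k : K) ^ 3 + (2 : K) * (k : K) ^ 4) * e_pp + ((-198 : K)
        + (-294 : K) * (k : K) + (-148 : K) * (k : K) ^ 2 + (-30 : K) * (k : K) ^ 3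
        + (-2 : K) * (k : K) ^ 4) * e_qq + ((-60 : K) + (-56 : K) * (k : K)
        + (10 : K) * (k : K) ^ 3 + (2 : K) * (k : K) ^ 4) * e_pq + ((6 : K) + (17 : K) * (k : K)
        + (17 : K) * (k : K) ^ 2 + (7 : K) * (k : K) ^ 3 + (1 : K) * (k : K) ^ 4) * e_qp
        + ((26 : K) + (26 : K) * (k : K) + (6 : K) * (k : K) ^ 2) * e_rowP + ((-2 : K)
        + (-5 : K) * (k : K) + (-4 : K) * (k : K) ^ 2 + (-1 : K) * (k : K) ^ 3) * e_rowQ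
        + ((-2 : K) + (-5 : K) * (k : K) + (-4 : K) * (k : K) ^ 2
        + (-1 : K) * (k : K) ^ 3) * e_colP + ((-70 : K) + (-86 : K) * (k : K)
        + (-32 : K) * (k : K) ^ 2 + (-4 : K) * (k : K) ^ 3) * e_colQ + ((6 : K)
        + (9 : K) * (k : K) + (3 : K) * (k : K) ^ 2) * e_all)).resolve_left hP3
  have hz7 : (∑ j, v (some (some j), none)) = 0 := (mul_eq_zero.mp (show ((192 : K)
      + (512 : K) * (k : K) + (508 : K) * (k : K) ^ 2 + (234 : K) * (k : K) ^ 3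
      + (50 : K) * (k : K) ^ 4 + (4 : K) * (k : K) ^ 5) * (∑ j, v (some (some j), none)) = 0 by
    linear_combination ((-198 : K) + (-294 : K) * (k : K) + (-148 : K) * (k : K) ^ 2
        + (-30 : K) * (k : K) ^ 3 + (-2 : K) * (k : K) ^ 4) * e_pp + ((90 : K)
        + (138 : K) * (k : K) + (78 : K) * (k : K) ^ 2 + (20 : K) * (k : K) ^ 3
        + (2 : K) * (k : K) ^ 4) * e_qq + ((-60 : K) + (-56 : K) * (k : K)
        + (10 : K) * (k : K) ^ 3 + (2 : K) * (k : K) ^ 4) * e_pq + ((6 : K) + (17 : K) * (k : K)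
        + (17 : K) * (k : K) ^ 2 + (7 : K) * (k : K) ^ 3 + (1 : K) * (k : K) ^ 4) * e_qp
        + ((-70 : K) + (-86 : K) * (k : K) + (-32 : K) * (k : K) ^ 2
        + (-4 : K) * (k : K) ^ 3) * e_rowP + ((-2 : K) + (-5 : K) * (k : K)
        + (-4 : K) * (k : K) ^ 2 + (-1 : K) * (k : K) ^ 3) * e_rowQ + ((-2 : K)
        + (-5 : K) * (k : K) + (-4 : K) * (k : K) ^ 2 + (-1 : K) * (k : K) ^ 3) * e_colP
        + ((26 : K) + (26 : K) * (k : K) + (6 : K) * (k : K) ^ 2) * e_colQ + ((6 : K)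
        + (9 : K) * (k : K) + (3 : K) * (k : K) ^ 2) * e_all)).resolve_left hP3
  have hz8 : (∑ j, v (some (some j), some none)) = 0 := (mul_eq_zero.mp (show ((192 : K)
      + (608 : K) * (k : K) + (764 : K) * (k : K) ^ 2 + (488 : K) * (k : K) ^ 3
      + (167 : K) * (k : K) ^ 4 + (29 : K) * (k : K) ^ 5
      + (2 : K) * (k : K) ^ 6) * (∑ j, v (some (some j), some none)) = 0 by
    linear_combination ((-162 : K) + (-264 : K) * (k : K) + (-157 : K) * (k : K) ^ 2
        + (-41 : K) * (k : K) ^ 3 + (-4 : K) * (k : K) ^ 4) * e_pp + ((-18 : K)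
        + (-48 : K) * (k : K) + (-44 : K) * (k : K) ^ 2 + (-16 : K) * (k : K) ^ 3
        + (-2 : K) * (k : K) ^ 4) * e_qq + ((60 : K) + (164 : K) * (k : K)
        + (171 : K) * (k : K) ^ 2 + (86 : K) * (k : K) ^ 3 + (21 : K) * (k : K) ^ 4
        + (2 : K) * (k : K) ^ 5) * e_pq + ((-78 : K) + (-143 : K) * (k : K)
        + (-96 : K) * (k : K) ^ 2 + (-28 : K) * (k : K) ^ 3 + (-3 : K) * (k : K) ^ 4) * e_qp
        + ((-98 : K) + (-152 : K) * (k : K) + (-85 : K) * (k : K) ^ 2 + (-21 : K) * (k : K) ^ 3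
        + (-2 : K) * (k : K) ^ 4) * e_rowP + ((-70 : K) + (-121 : K) * (k : K)
        + (-75 : K) * (k : K) ^ 2 + (-20 : K) * (k : K) ^ 3 + (-2 : K) * (k : K) ^ 4) * e_rowQ
        + ((26 : K) + (39 : K) * (k : K) + (19 : K) * (k : K) ^ 2
        + (3 : K) * (k : K) ^ 3) * e_colP + ((46 : K) + (64 : K) * (k : K)
        + (28 : K) * (k : K) ^ 2 + (4 : K) * (k : K) ^ 3) * e_colQ + ((18 : K)
        + (25 : K) * (k : K) + (12 : K) * (k : K) ^ 2
        + (2 : K) * (k : K) ^ 3) * e_all)).resolve_left hP1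
  have hz9 : (∑ j, v (some (some j), some (some j))) = 0 := (mul_eq_zero.mp (show ((192 : K)
      + (512 : K) * (k : K) + (508 : K) * (k : K) ^ 2 + (234 : K) * (k : K) ^ 3
      + (50 : K) * (k : K) ^ 4
      + (4 : K) * (k : K) ^ 5) * (∑ j, v (some (some j), some (some j))) = 0 by
    linear_combination ((18 : K) + (-8 : K) * (k : K) ^ 2 + (-2 : K) * (k : K) ^ 3) * e_pp
        + ((18 : K) + (-8 : K) * (k : K) ^ 2 + (-2 : K) * (k : K) ^ 3) * e_qq + ((-108 : K)
        + (-156 : K) * (k : K) + (-70 : K) * (k : K) ^ 2 + (-10 : K) * (k : K) ^ 3) * e_pq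
        + ((-18 : K) + (-33 : K) * (k : K) + (-18 : K) * (k : K) ^ 2
        + (-3 : K) * (k : K) ^ 3) * e_qp + ((18 : K) + (16 : K) * (k : K)
        + (4 : K) * (k : K) ^ 2) * e_rowP + ((6 : K) + (9 : K) * (k : K)
        + (3 : K) * (k : K) ^ 2) * e_rowQ + ((6 : K) + (9 : K) * (k : K)
        + (3 : K) * (k : K) ^ 2) * e_colP + ((18 : K) + (16 : K) * (k : K)
        + (4 : K) * (k : K) ^ 2) * e_colQ + ((96 : K) + (256 : K) * (k : K)
        + (254 : K) * (k : K) ^ 2 + (117 : K) * (k : K) ^ 3 + (25 : K) * (k : K) ^ 4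
        + (2 : K) * (k : K) ^ 5) * e_diag + ((78 : K) + (151 : K) * (k : K)
        + (94 : K) * (k : K) ^ 2 + (23 : K) * (k : K) ^ 3
        + (2 : K) * (k : K) ^ 4) * e_all)).resolve_left hP3
  have hz10 : (∑ j, ∑ i, v (some (some j), some (some i))) = 0 := (mul_eq_zero.mp (show ((192 : K)
      + (512 : K) * (k : K) + (508 : K) * (k : K) ^ 2 + (234 : K) * (k : K) ^ 3
      + (50 : K) * (k : K) ^ 4
      + (4 : K) * (k : K) ^ 5) * (∑ j, ∑ i, v (some (some j), some (some i))) = 0 by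
    linear_combination ((54 : K) + (18 : K) * (k : K) + (-24 : K) * (k : K) ^ 2
        + (-14 : K) * (k : K) ^ 3 + (-2 : K) * (k : K) ^ 4) * e_pp + ((54 : K)
        + (18 : K) * (k : K) + (-24 : K) * (k : K) ^ 2 + (-14 : K) * (k : K) ^ 3
        + (-2 : K) * (k : K) ^ 4) * e_qq + ((-324 : K) + (-576 : K) * (k : K)
        + (-366 : K) * (k : K) ^ 2 + (-100 : K) * (k : K) ^ 3 + (-10 : K) * (k : K) ^ 4) * e_pq
        + ((-54 : K) + (-117 : K) * (k : K) + (-87 : K) * (k : K) ^ 2 + (-27 : K) * (k : K) ^ 3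
        + (-3 : K) * (k : K) ^ 4) * e_qp + ((54 : K) + (66 : K) * (k : K) + (28 : K) * (k : K) ^ 2
        + (4 : K) * (k : K) ^ 3) * e_rowP + ((18 : K) + (33 : K) * (k : K)
        + (18 : K) * (k : K) ^ 2 + (3 : K) * (k : K) ^ 3) * e_rowQ + ((18 : K)
        + (33 : K) * (k : K) + (18 : K) * (k : K) ^ 2 + (3 : K) * (k : K) ^ 3) * e_colP
        + ((54 : K) + (66 : K) * (k : K) + (28 : K) * (k : K) ^ 2
        + (4 : K) * (k : K) ^ 3) * e_colQ + ((192 : K) + (512 : K) * (k : K)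
        + (508 : K) * (k : K) ^ 2 + (234 : K) * (k : K) ^ 3 + (50 : K) * (k : K) ^ 4
        + (4 : K) * (k : K) ^ 5) * e_diag + ((138 : K) + (275 : K) * (k : K)
        + (179 : K) * (k : K) ^ 2 + (46 : K) * (k : K) ^ 3
        + (4 : K) * (k : K) ^ 4) * e_all)).resolve_left hP3
  exact ⟨hz1, hz2, hz3, hz4, hz5, hz6, hz7, hz8, hz9, hz10⟩

end Summit.ValiantsHypothesis.ValiantsHypothesis.Theorems.FermionicJet.CdetHessian
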